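import Summits.ResolutionOfSingularities.ResolutionOfSingularities.Theorems.FrobeniusLadderFInjectiveMacaulayficationOmegaLocalCureRowAllPoints
import Summits.ResolutionOfSingularities.ResolutionOfSingularities.Theorems.FrobeniusLadderFInjectiveMacaulayficationOmegaLocalCureRowClosedPoints
import Summits.ResolutionOfSingularities.ResolutionOfSingularities.Theorems.FrobeniusLadderFInjectiveMacaulayficationHypersurfaceFullClAllPoints
import Summits.ResolutionOfSingularities.ResolutionOfSingularities.Theorems.FrobeniusLadderFInjectiveMacaulayficationSigma7Lx6q7PointFloorRowClass
import Summits.ResolutionOfSingularities.ResolutionOfSingularities.Theorems.FrobeniusLadderFInjectiveMacaulayficationCompositeFloorAdmissible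
import Summits.ResolutionOfSingularities.ResolutionOfSingularities.Theorems.FrobeniusLadderFInjectiveMacaulayficationB9OmegaChartLetters
import Summits.ResolutionOfSingularities.ResolutionOfSingularities.Theorems.FrobeniusLadderFInjectiveMacaulayficationSeparableBaseChangeAscent
import Summits.ResolutionOfSingularities.ResolutionOfSingularities.Theorems.FrobeniusLadderFInjectiveMacaulayficationDiagonalBPCIRowTwoSided
import Summits.ResolutionOfSingularities.ResolutionOfSingularities.Theorems.FrobeniusLadderFInjectiveMacaulayficationOmegaCrossingCureRow
import Summits.ResolutionOfSingularities.ResolutionOfSingularities.Theorems.FrobeniusLadderFInjectiveMacaulayficationEtaleModelTransportQuotient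
import Summits.ResolutionOfSingularities.ResolutionOfSingularities.Theorems.FrobeniusLadderFInjectiveMacaulayficationBlowupPairStalkCM
import Summits.ResolutionOfSingularities.ResolutionOfSingularities.Theorems.FrobeniusLadderFInjectiveMacaulayficationWildCoverFedder
import Summits.ResolutionOfSingularities.ResolutionOfSingularities.Theorems.FrobeniusLadderFInjectiveMacaulayficationPencilDeepSupportFedder
import Summits.ResolutionOfSingularities.ResolutionOfSingularities.Theorems.FrobeniusLadderFInjectiveMacaulayficationPencilChartPackage
import Summits.ResolutionOfSingularities.ResolutionOfSingularities.Theorems.FrobeniusLadderFInjectiveMacaulayficationPencilPairPrimality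
import Summits.ResolutionOfSingularities.ResolutionOfSingularities.Theorems.FrobeniusLadderFInjectiveMacaulayficationB9OmegaChartPrimes
import Summits.ResolutionOfSingularities.ResolutionOfSingularities.Theorems.FrobeniusLadderFInjectiveMacaulayficationFullWeightBudget
import Summits.ResolutionOfSingularities.ResolutionOfSingularities.Theorems.FrobeniusLadderFInjectiveMacaulayficationFullWildForm
import Summits.ResolutionOfSingularities.ResolutionOfSingularities.Theorems.FrobeniusLadderFInjectiveMacaulayficationFullPthPowerEdge
import Summits.ResolutionOfSingularities.ResolutionOfSingularities.Theorems.FrobeniusLadderFInjectiveMacaulayficationFullXMulRestriction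
import Summits.ResolutionOfSingularities.ResolutionOfSingularities.Theorems.FrobeniusLadderFInjectiveMacaulayficationFullLineageDisc
import Summits.ResolutionOfSingularities.ResolutionOfSingularities.Theorems.FrobeniusLadderFInjectiveMacaulayficationFullPointChainCap
import Summits.ResolutionOfSingularities.ResolutionOfSingularities.Theorems.FrobeniusLadderFInjectiveMacaulayficationOmegaCureCentreFactors
import Summits.ResolutionOfSingularities.ResolutionOfSingularities.Theorems.FrobeniusLadderFInjectiveMacaulayficationPencilStalkPackage
import Summits.ResolutionOfSingularities.ResolutionOfSingularities.Theorems.FrobeniusLadderFInjectiveMacaulayficationPencilBlowupLocalChartsFull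
import Summits.ResolutionOfSingularities.ResolutionOfSingularities.Theorems.FrobeniusLadderFInjectiveMacaulayficationPencilQuotLocalization
import Summits.ResolutionOfSingularities.ResolutionOfSingularities.Theorems.FrobeniusLadderFInjectiveMacaulayficationOmegaOneFloorCM
import HarnessLib

/-!
# F-CENSUS REGISTRAR v4 (second volume; `…FCensusRegistrar` v1–v3 ✓p687725/✓p689758/✓p691771 is at its 400-line cap): one-name aliases for what landed on BED Ω (the pencil-chart
# soundness dictionary, the strengthened certificates, the Ω₁ LOCAL CURE ROW at every point, the legal-letter schema, the chart letters and the étale engines) and cross-certificate #2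
# (crux `FInjectiveMacaulayfication` stmt-ResolutionOfSingularities-15315, chain w45a; res-L1-w45a-plan-1 R23.15 (2) / R23.18 «registrar v4 `…FCensusRegistrar2.lean` — batch once»; seat
# res-L1-w45a-stub-1 g15)

[OURS · L1 W4.5a] Support file (`--supports stmt-ResolutionOfSingularities-15315 --as helper`); `alias`es of LANDED theorems + two conjunction theorems; no new mathematics; nothing of
the crux is proved; every row is OURS and counted 0; an F-census row records «LEGAL ∧ NOT FULL ∧ CURED» for ONE floor, never the crux. AI-written (AI review weaker than expert review).
* §1 cross-certificate #2 (row #4ᵖᵗ, lx6q7 ∘ σ₇: data route ✓p699896 vs class route ✓p689857); §2 BED Ω soundness dictionary (MASTER ✓p701797; certificates ✓p701878); §3 ★★★ the Ω₁ LOCAL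
  CURE ROW (✓p702704 → ✓p703736 → ✓p704374, every point, every field of char `p ≥ 5`; census by code); §4 schema + letters + engines (✓p703009, ✓p703355/✓p703845, ✓p703692,
  ✓p703993, ✓p704416, ✓p704064); §5 ★★★ ROW #11 = the first NON-HYPERSURFACE two-sided row (BED CI-1, res-L1-w45a-stub-2 g13: `row11_CI1_pointFloor`, p ≥ 7, any field) with its
  columns; §6 conjunction theorems `omega1_census`, `omega1_certificates`.
[cite: Fedder1983, Thm. 1.12; CoxLittleSchenck2011, §2.3]
-/

set_option linter.dupNamespace false

noncomputable section

namespace Summit.ResolutionOfSingularities.ResolutionOfSingularities.Theorems.FInjectiveMacaulayfication.FCensusRegistrar2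

open Summit.ResolutionOfSingularities.ResolutionOfSingularities.Theorems.FInjectiveMacaulayfication

/-! ## §1 Cross-certificate #2: row #4ᵖᵗ by two independent kernel routes -/

/-- XCERT #2 (data route, 357-chart fan): row #4ᵖᵗ `lx6q7 ∘ σ₇` point floor, LEGAL ∧ NOT FULL ∧ CURED. [alias of ✓p699896] -/
alias xcert4pt_lx6q7_data_row := Sigma7Lx6q7PointFloorRowClass.f4pos_row_sigma7_class
/-- XCERT #2 (data route): the point-floor row statement. [alias of ✓p699896] -/
alias xcert4pt_lx6q7_data_pointFloor := Sigma7Lx6q7PointFloorRowClass.pointFloor_sigma7_row_class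
/-- XCERT #2 (data route): the germ form. [alias of ✓p699896] -/
alias xcert4pt_lx6q7_data_germ := Sigma7Lx6q7PointFloorRowClass.sigma7_fInjectivizationGermAt

/-! ## §2 BED Ω — the pencil-chart soundness dictionary -/

/-- MASTER, `W`-chart: nine-way exit tag ⇒ `FullCl` at `(w₀; c)`, every `w₀`, `p ≥ 5`. [alias of ✓p701797] -/
alias omega_master_W := PencilExitTagMaster.fullCl_pencilChartW_of_tag
/-- MASTER, `U`-chart pole. [alias of ✓p701797] -/
alias omega_master_U_pole := PencilExitTagMaster.fullCl_pencilChartU_pole_of_tag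
/-- MASTER, `U`-chart every `u₀` (pole + chart-gluing transfer ✓p701234). [alias of ✓p701797] -/
alias omega_master_U := PencilExitTagMaster.fullCl_pencilChartU_of_tag
/-- The chart-gluing transfer `W ↔ U`. [alias of ✓p701234] -/
alias omega_transfer_WU := PencilChartTransfer.fullCl_pencilChart_transfer_WU
/-- Strengthened exit certificates (code 5/6 letter conjunct), G9. [alias of ✓p701878] -/
alias omega_cert'_G9 := OmegaOneCureFanCertStrong.cert'_G9
/-- Strengthened exit certificates, G10. [alias of ✓p701878] -/
alias omega_cert'_G10 := OmegaOneCureFanCertStrong.cert'_G10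
/-- Strengthened exit certificates, G10Q. [alias of ✓p701878] -/
alias omega_cert'_G10Q := OmegaOneCureFanCertStrong.cert'_G10Q

/-! ## §3 ★★★ The Ω₁ LOCAL CURE ROW (res-L1-w45a-stub-3 g13) -/

/-- `exitOK'` ⇒ the MASTER's nine-way disjunction. [alias of ✓p702306] -/
alias omega1_tag_of_exitOK' := OmegaExitTag.tag_of_exitOK'
/-- Census by code, G9 = 259 pairs `[48,203,4,4,0,0,0,0,0]`. [alias of ✓p702704] -/
alias omega1_census_G9 := OmegaLocalCureRow.census_G9
/-- Census by code, G10 = 455 pairs. [alias of ✓p702704] -/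
alias omega1_census_G10 := OmegaLocalCureRow.census_G10
/-- Census by code, G10Q = 975 pairs (181 code 5). [alias of ✓p702704] -/
alias omega1_census_G10Q := OmegaLocalCureRow.census_G10Q
/-- ★★★ Ω₁ LOCAL ROW, G9 `W`-charts, k-rational closed points. [alias of ✓p702704] -/
alias omega1_G9_W := OmegaLocalCureRow.omega1_G9_pencilChartW_fullCl
/-- Ω₁ LOCAL ROW, G9 `U`-charts. [alias of ✓p702704] -/
alias omega1_G9_U := OmegaLocalCureRow.omega1_G9_pencilChartU_fullCl
/-- Ω₁ LOCAL ROW, G10 `W`. [alias of ✓p702704] -/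
alias omega1_G10_W := OmegaLocalCureRow.omega1_G10_pencilChartW_fullCl
/-- Ω₁ LOCAL ROW, G10 `U`. [alias of ✓p702704] -/
alias omega1_G10_U := OmegaLocalCureRow.omega1_G10_pencilChartU_fullCl
/-- Ω₁ LOCAL ROW, G10Q `W`. [alias of ✓p702704] -/
alias omega1_G10Q_W := OmegaLocalCureRow.omega1_G10Q_pencilChartW_fullCl
/-- Ω₁ LOCAL ROW, G10Q `U`. [alias of ✓p702704] -/
alias omega1_G10Q_U := OmegaLocalCureRow.omega1_G10Q_pencilChartU_fullCl
/-- ★★★ Ω₁ LOCAL ROW AT EVERY POINT (scheme-theoretic), G9 `W`. [alias of ✓p704374] -/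
alias omega1_G9_W_allPoints := OmegaLocalCureRowAllPoints.omega1_G9_pencilChartW_fullCl_allPoints
/-- Ω₁ every point, G9 `U`. [alias of ✓p704374] -/
alias omega1_G9_U_allPoints := OmegaLocalCureRowAllPoints.omega1_G9_pencilChartU_fullCl_allPoints
/-- Ω₁ every point, G10 `W`. [alias of ✓p704374] -/
alias omega1_G10_W_allPoints := OmegaLocalCureRowAllPoints.omega1_G10_pencilChartW_fullCl_allPoints
/-- Ω₁ every point, G10 `U`. [alias of ✓p704374] -/
alias omega1_G10_U_allPoints := OmegaLocalCureRowAllPoints.omega1_G10_pencilChartU_fullCl_allPoints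
/-- Ω₁ every point, G10Q `W`. [alias of ✓p704374] -/
alias omega1_G10Q_W_allPoints := OmegaLocalCureRowAllPoints.omega1_G10Q_pencilChartW_fullCl_allPoints
/-- Ω₁ every point, G10Q `U`. [alias of ✓p704374] -/
alias omega1_G10Q_U_allPoints := OmegaLocalCureRowAllPoints.omega1_G10Q_pencilChartU_fullCl_allPoints
/-- GAP-2 engine: hypersurface FULL at every point from FULL at the k̄-rational points. [alias of ✓p704064] -/
alias engine_hypersurface_fullCl_allPoints := HypersurfaceFullClAllPoints.hypersurface_fullCl_of_rational_over_algClosed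

/-! ## §4 BED Ω global half: legal-letter schema, chart letters, étale engines -/

/-- (g-c) the composite floor is admissible ((L1)–(L4) of the F-half stub, verbatim). [alias of ✓p703009] -/
alias omega_admissible_of_composite := CompositeFloorAdmissible.admissible_of_composite
/-- (g-c) the F-half stub cures every composite floor with CM stalks (stub as hypothesis). [alias of ✓p703009] -/
alias omega_fHalf_cures_composite := CompositeFloorAdmissible.fHalf_cures_composite
/-- (g-a) chart 5: `f ↦ y₄⁹·θ₅`. [alias of ✓p703355] -/
alias omega_chart5_f := B9OmegaChartLetters.chart5_f
/-- (g-a) chart 22: `f ↦ y₃⁹y₄¹⁸·θ₂₂` (polynomial chart). [alias of ✓p703355] -/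
alias omega_chart22_f := B9OmegaChartLetters.chart22_f
/-- (g-a) chart 4: `f ↦ y₃⁹y₄¹⁸·θ₄` (G10 letters on the nose). [alias of ✓p703845] -/
alias omega_chart4_f := B9OmegaChartLetters.chart4_f
/-- Étale engine: the stalk clause of a hypersurface is invariant along faithfully flat unramified maps of regular local rings. [alias of ✓p703692] -/
alias engine_clause_iff_faithfullyFlat := FedderEtaleAscent.clause_hypersurface_iff_of_faithfullyFlat
/-- Étale engine: `A_p → B_P` faithfully flat for `B` flat over `A`. [alias of ✓p703993] -/
alias engine_faithfullyFlat_atPrime := StandardEtaleLocal.faithfullyFlat_atPrime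
/-- Étale engine: unramified from `P = p·B + (g)`, `u·g ∈ p·B`. [alias of ✓p703993] -/
alias engine_unramified_of_generator := StandardEtaleLocal.map_maximalIdeal_eq_of_generator
/-- (RF) finite separable base change: the stalk clause both ways. [alias of ✓p704416] -/
alias engine_clause_iff_separable_baseChange := SeparableBaseChangeAscent.clause_hypersurface_iff_separable_baseChange

/-! ## §5 ★★★ ROW #11 — BED CI-1, the diagonal Brieskorn–Pham complete intersection pair (res-L1-w45a-stub-2 g13) -/

/-- ★★★ ROW #11 (first NON-HYPERSURFACE census row): point floor of BED CI-1 — LEGAL ∧ NOT FULL ∧ CURED, `p ≥ 7`, any field of char `p`. [alias of `DiagonalBPCIRowTwoSided`] -/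
alias row11_CI1_pointFloor := DiagonalBPCIRowTwoSided.row11_CI1_pointFloor
/-- ROW #11, registrar wording «non-hypersurface row». [alias] -/
alias row11_nonHypersurface := DiagonalBPCIRowTwoSided.row_nonHypersurface_diagonalBPCI
/-- ROW #11 column INPUT NOT-FULL (the vertex of BED CI-1 is not FULL, p-uniform). [alias of ✓p701932] -/
alias row11_input_not_full := DiagonalBPCIVertexNotFull.diagonalBPCI_vertex_not_full
/-- ROW #11 column FLOOR NOT-FULL (chart 5 of the point floor). [alias of ✓p703156] -/
alias row11_floor_not_full := DiagonalBPCIChart5NotFull.diagonalBPCI_pointFloor_not_full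
/-- ROW #11 column FLOOR LEGAL. [alias] -/
alias row11_floor_legal := DiagonalBPCIPointFloorLegal.diagonalBPCI_pointFloor_input_legal
/-- ROW #11 column CURED (the class route for complete intersections). [alias] -/
alias row11_cured := DiagonalBPCIRow.diagonalBPCI_pointFloorCured

/-! ## §6 Conjunction theorems (one-line index) -/

/-- **Ω₁ CENSUS BY CODE, ALL THREE FANS**: 259 + 455 + 975 (cone, orbit) pairs with the printed code counts. [index of ✓p702704] -/
theorem omega1_census : (OmegaOneCureFanCert.TAGS_G9.flatten.length = 259 ∧ ((List.range 9).map fun t => OmegaOneCureFanCert.TAGS_G9.flatten.count t) = [48, 203, 4, 4, 0, 0, 0, 0, 0]) ∧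
    (OmegaOneCureFanCert.TAGS_G10.flatten.length = 455 ∧ ((List.range 9).map fun t => OmegaOneCureFanCert.TAGS_G10.flatten.count t) = [82, 366, 7, 0, 0, 0, 0, 0, 0]) ∧
    (OmegaOneCureFanCert.TAGS_G10Q.flatten.length = 975 ∧ ((List.range 9).map fun t => OmegaOneCureFanCert.TAGS_G10Q.flatten.count t) = [229, 546, 13, 0, 6, 181, 0, 0, 0]) :=
  ⟨OmegaLocalCureRow.census_G9, OmegaLocalCureRow.census_G10, OmegaLocalCureRow.census_G10Q⟩

/-- **Ω₁ STRENGTHENED EXIT CERTIFICATES, ALL THREE FANS**. [index of ✓p701878] -/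
theorem omega1_certificates : OmegaOneCureFanCertStrong.checkExits' 3 22 2 [2, 0, 0] [0, 3, 0] OmegaOneCureFanCert.RAYS_G9 OmegaOneCureFanCert.CONES_G9 OmegaOneCureFanCert.ORB3
      OmegaOneCureFanCert.TAGS_G9 = true ∧
    OmegaOneCureFanCertStrong.checkExits' 3 43 2 [2, 0, 0] [0, 3, 0] OmegaOneCureFanCert.RAYS_G10 OmegaOneCureFanCert.CONES_G10 OmegaOneCureFanCert.ORB3 OmegaOneCureFanCert.TAGS_G10 = true ∧
    OmegaOneCureFanCertStrong.checkExits' 4 43 3 [1, 2, 0, 0] [0, 0, 3, 0] OmegaOneCureFanCert.RAYS_G10Q OmegaOneCureFanCert.CONES_G10Q OmegaOneCureFanCert.ORB4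
      OmegaOneCureFanCert.TAGS_G10Q = true :=
  ⟨OmegaOneCureFanCertStrong.cert'_G9, OmegaOneCureFanCertStrong.cert'_G10, OmegaOneCureFanCertStrong.cert'_G10Q⟩

/-! ## §7 (v4.1) MODEL #4 «G9∧10» at the nine crossings: kernel certificate (✓p705432, cross-certificate #3 by res-L1-w45a-tri-2 g21 #69/#71), the crossing cure row at every point and
the THREE GLUING EQUALITIES of the Ω₁ global fan of record (✓p706604, res-L1-w45a-stub-3 g13) -/

/-- XCERT #3: the model-#4 fan Σ₄ passes the strengthened exit check (codes 0–3 only). [alias of ✓p705432] -/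
alias xcert3_omega1_G4_cert := OmegaCrossingCureFanCert.cert'_G4
/-- Census by code, Σ₄: 7 500 pairs, `{0: 1578, 1: 5863, 2: 51, 3: 8}`. [alias of ✓p705432] -/
alias omega1_census_G4 := OmegaCrossingCureFanCert.census_G4
/-- GLUING Σ₄|{ρ₃ = 0} = F9. [alias of ✓p705432] -/
alias omega1_face9_G4 := OmegaCrossingCureFanCert.face9_G4
/-- GLUING Σ₄|{ρ₂ = 0} = F10. [alias of ✓p705432] -/
alias omega1_face10_G4 := OmegaCrossingCureFanCert.face10_G4
/-- GLUING G10Q|{x₀ = 0} = G10. [alias of ✓p706604] -/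
alias omega1_face10_G10Q := OmegaCrossingCureRow.face10_G10Q
/-- ★★★ THE Ω₁ GLOBAL FAN OF RECORD GLUES (three restriction equalities + E-adaptedness, one conjunction). [alias of ✓p706604] -/
alias omega1_fan_of_record_glues := OmegaCrossingCureRow.omega1_fan_of_record_glues
/-- ★★★ MODEL #4 CURE ROW, `W`-charts, EVERY point (p ≥ 5, any field). [alias of ✓p706604] -/
alias omega1_G4_W_allPoints := OmegaCrossingCureRow.omega1_G4_pencilChartW_fullCl_allPoints
/-- MODEL #4 CURE ROW, `U`-charts, every point. [alias of ✓p706604] -/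
alias omega1_G4_U_allPoints := OmegaCrossingCureRow.omega1_G4_pencilChartU_fullCl_allPoints
/-- MODEL #4 CURE ROW, `W`-charts, k-rational closed points. [alias of ✓p706604] -/
alias omega1_G4_W := OmegaCrossingCureRow.omega1_G4_pencilChartW_fullCl
/-- MODEL #4 CURE ROW, `U`-charts, k-rational closed points. [alias of ✓p706604] -/
alias omega1_G4_U := OmegaCrossingCureRow.omega1_G4_pencilChartU_fullCl

/-! ## §8 (v5) THE ÉTALE TRANSPORT LAYER (✓p708620 / ✓p708879) THE F4(c) GLUE (✓p709834) AND THE WILD p-COVER DICTIONARY (✓p710453) (res-L1-w45a-stub-1 g15): model stalk ↔ actual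
stalk through a common étale neighbourhood (LEG := flat + `𝔪_A·C = 𝔪_C`); blow-up stalks along `γ·(a, b)` are CM; Fedder of `z^p = F` lives one dimension down -/

/-- FULL DESCENDS along a leg (`FullCl p C → FullCl p A`). [alias of ✓p708620] -/
alias transport_fullCl_of_leg := EtaleModelTransport.fullCl_of_leg
/-- The CM clause is invariant along a leg (both ways; F4(c)). [alias of ✓p708620] -/
alias transport_cmCl_iff := EtaleModelTransport.cmCl_iff
/-- Regularity is invariant along a leg (Matsumura 23.7). [alias of ✓p708620] -/
alias transport_isRegularLocalRing_iff := EtaleModelTransport.isRegularLocalRing_iff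
/-- ★★ FULL transports model ⇒ actual in the two-leg hypersurface frame (model #4 at the nine P_ζ). [alias of ✓p708620] -/
alias transport_fullCl_hypersurface := EtaleModelTransport.fullCl_hypersurface_transport
/-- ★★ FULL ascends model ⇒ actual along one hypersurface leg up to a unit (charts 5 / 23). [alias of ✓p708620] -/
alias transport_fullCl_hypersurface_leg := EtaleModelTransport.fullCl_hypersurface_leg_of
/-- The CM clause of the hypersurface is étale-local (quotient leg; no Fedder, no regular ambient). [alias of ✓p708879] -/
alias transport_cmCl_hypersurface_leg_iff := EtaleModelTransport.cmCl_hypersurface_leg_iff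
/-- Regularity of the hypersurface is étale-local (quotient leg). [alias of ✓p708879] -/
alias transport_isRegularLocalRing_hypersurface_leg_iff := EtaleModelTransport.isRegularLocalRing_hypersurface_leg_iff
/-- FULL of `R/I` descends along the quotient leg. [alias of ✓p708879] -/
alias transport_fullCl_of_quotient_leg := EtaleModelTransport.fullCl_of_quotient_leg
/-- ★★ F4(c) GLUE, generic per-stalk form: the stalks of a blowing up along `γ·(a, b)` (`(a, b)` a regular pair of a regular local ring) satisfy
the CM clause. [alias of ✓p709834] -/
alias glue_cmCl_stalk_of_isBlowup_pair := BlowupPairStalkCM.cmCl_stalk_of_isBlowup_pair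
/-- ★★ WILD p-COVER: FULL(`z^p = F` at 0) ⟺ Fedder(`F`) at 0 — the test lives one dimension down. [alias of ✓p710453] -/
alias wild_frobeniusPower_mem_iff_of_pCover := WildCoverFedder.frobeniusPower_mem_iff_of_pCover
/-- ★★ WILD CHART `x^c z^p = G` at a k-point `(ζ, β)`: Fedder test ⟺ Fedder test of the twisted base `G − ζ^p x^c` at `β`. [alias of ✓p710453] -/
alias wild_frobeniusPower_mem_iff_wildChart := WildCoverFedder.frobeniusPower_mem_iff_wildChart
/-- ★★ The stalk clause of the wild chart at a k-point, one dimension down. [alias of ✓p710453] -/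
alias wild_clause_wildChart_iff := WildCoverFedder.clause_wildChart_iff


/-! ## §9 (v6) F4(c) PER-CHART PACKAGES AND KIT (res-L1-w45a-stub-3 g14: ✓p711252 / ✓p712528 / ✓p712813 `B9OmegaChartPrimes`), DEEP-SUPPORT FEDDER (✓p712178), THE T-SIDE BRICKS K4 / K5 / EDGE
(res-L1-w45a-lead-1 g14 ✓p711058 / ✓p711673; res-L1-w45a-stub-1 g16 ✓p712909 `FullPthPowerEdge`) — res-L1-w45a-plan-1 R24.11 / R24.21 / R24.10 (4) / BOOKED 10:03:58Z («registrar v6 column deep-support Fedder YES, with the next batch»)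

STATUS LINE OF RECORD (R24.21): ✓p711812 `…PencilChartPairInstances` (res-L1-w45a-stub-1 g16: families A/B of the per-chart pair primalities in «linear-first» letters; landed on the
olean lane) is a PARALLEL instance file — NOT to be cited; superseded by res-L1-w45a-stub-3ʼs consumer-owned ✓p712813 `B9OmegaChartPrimes` (the twelve `isPrime_pair_c…` in table letters
feeding ✓p712528) together with its `B9OmegaChartData{0..4}` (the side conditions `not_dvd_chi_c`, `M1_not_mem_c`). -/

/-- ★ F4(c) KIT: `T⁺` is regular on `k[y₀..y_m]/(χ⁺, y₀^e)` for `χ` prime, `χ ∤ T`, both free of `y₀` (the `hreg` of the `y₀²·y₄`-type charts). [alias of ✓p711252, res-L1-w45a-stub-3] -/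
alias kit_reg_of_free := PencilPairPrimality.reg_of_free
/-- F4(c) KIT: pair-ideal primality transports along a variable permutation. [alias of ✓p711252, res-L1-w45a-stub-3] -/
alias kit_isPrime_span_pair_rename_equiv := PencilPairPrimality.isPrime_span_pair_rename_equiv
/-- ★ F4(c) PACKAGE: the chart ideal of the second centre `(I_A + (g₀))·𝒪_{X̃}` on `U_c` is `Φ⁻¹(ȳ^G ȳ^{M₁}, ȳ^G χ̄)`. [alias of ✓p712528, res-L1-w45a-stub-3] -/
alias package_ideal_chart_eq := PencilChartPackage.ideal_chart_eq
/-- ★★ F4(c) PACKAGE (P): over a PENCIL chart (`θ` prime, `θ ∤ χ`, `(θ, χ)` prime `∌ y^{M₁}`) every stalk of `S′ = Bl X̃` is CM. [alias of ✓p712528, res-L1-w45a-stub-3] -/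
alias package_cmCl_stalk_over_pencilChart := PencilChartPackage.cmCl_stalk_over_pencilChart
/-- ★★ F4(c) PACKAGE (Q): over a PRINCIPAL chart (`ȳ^{M₁}` a unit, `θ ∤ y^G`) `S′ → X̃` is an isomorphism and the CM clause passes. [alias of ✓p712528, res-L1-w45a-stub-3] -/
alias package_cmCl_stalk_over_principalChart := PencilChartPackage.cmCl_stalk_over_principalChart
/-- ★★ THE TWELVE PENCIL CHARTS OF `X̃_{B9}`: `(θ_c, χ_c)` prime on chart 22 (table letters). [alias of ✓p712813, res-L1-w45a-stub-3] -/
alias omega1_isPrime_pair_c22 := B9OmegaChartPrimes.isPrime_pair_c22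
/-- `(θ_c, χ_c)` prime on chart 5 (the `y₀²·y₄` family, via `kit_reg_of_free`). [alias of ✓p712813, res-L1-w45a-stub-3] -/
alias omega1_isPrime_pair_c5 := B9OmegaChartPrimes.isPrime_pair_c5
/-- The three strict-transform shapes of `f_{B9}` on the charts meeting `E₉ ∪ E₁₀` are prime (`θ_A`-shape). [alias of ✓p712813, res-L1-w45a-stub-3] -/
alias omega1_prime_thetaT1 := B9OmegaChartPrimes.prime_thetaT1
/-- ★★ DEEP-SUPPORT FEDDER, `W`-chart: with `M ∈ ((yᵢ − βᵢ)^p)`, `(M⁺·W − B⁺)^m ∈ J_{(w₀;β)} ↔ B^m ∈ ((yᵢ − βᵢ)^p)` for EVERY `w₀`. [alias of ✓p712178] -/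
alias deep_pencilW_pow_mem_iff := PencilDeepSupportFedder.pencilW_pow_mem_iff_of_deep
/-- ★★ DEEP-SUPPORT FEDDER, `U`-pole: `(B⁺·U − M⁺)^{p−1} ∈ J_{(0;β)} ↔ B^{p−1} ∈ ((yᵢ − βᵢ)^p)`. [alias of ✓p712178] -/
alias deep_pencilU_pow_mem_iff := PencilDeepSupportFedder.pencilU_pow_mem_iff_of_deep
/-- ★★ DEEP-SUPPORT FEDDER, stalk clause: `CMCl ∧ FCl p` of the `W`-chart at `(w₀; β)` ⟺ `B^{p−1} ∉ ((yᵢ − βᵢ)^p)` — F-purity is constant along `ℙ¹_Q` and equals Fedder(`V(B)`) at `Q`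
(res-L1-w45a-tri-2ʼs (†), corollary (a); R24.7 (b) TIER). [alias of ✓p712178] -/
alias deep_clause_pencilW_iff := PencilDeepSupportFedder.clause_pencilW_iff_of_deep
/-- The same at the `U`-pole `W = ∞`. [alias of ✓p712178] -/
alias deep_clause_pencilU_pole_iff := PencilDeepSupportFedder.clause_pencilU_pole_iff_of_deep
/-- ★ K4 (T-register, lc budget B1): a weighted Fedder survivor bounds the weighted order by the sum of the weights. [alias of ✓p711058, res-L1-w45a-lead-1] -/
alias tside_le_sum_weights_of_survivor := FullWeightBudget.le_sum_weights_of_survivor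
/-- K4 corollary: the slope budget. [alias of ✓p711058, res-L1-w45a-lead-1] -/
alias tside_slope_budget := FullWeightBudget.slope_budget
/-- ★ K5 (wild form): a homogeneous form of degree `p` all of whose partials vanish is the `p`-th power of a linear form (domain of char `p`). [alias of ✓p711673, res-L1-w45a-lead-1] -/
alias tside_exists_linear_pow_eq_of_isHomogeneous := FullWildForm.exists_linear_pow_eq_of_isHomogeneous
/-- ★★ EDGE LEMMA (R24.10 (4), row #9♯): `n ≤ p`, `ℓ ∈ 𝔪`, `ord h ≥ p + 1` (mixed terms) ⇒ `(ℓ^p + h)^{p−1} ∈ 𝔪^{[p]}` — no `p`-th-power top layer on a FULL floor in `≤ p` letters.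
[alias of ✓p712909] -/
alias tside_not_survivor_of_pth_power_add := FullPthPowerEdge.not_survivor_of_pth_power_add

/-! ## §10 (v7) TC-β (✓p717528), THE DISCRIMINANT BRICKS K6 / K7 (res-L1-w45a-lead-1 g14 ✓p715854 / ✓p717266; `Lines/T-register.md` rev 8 ROW #11♯), F5 STRUCTURE (✓p713675) AND THE F6 GLUE
(res-L1-w45a-stub-3 g14 ✓p713989 / ✓p715362–✓p715801 / ✓p716077); cross-certificate #4 (chart data, two engines, 25/25 charts: res-L1-w45a-stub-1 g16 `g16-charts.py` vs ✓ `B9OmegaChartData0–4`, R25.1 (c)).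
OF RECORD BUT NOT YET ALIASED HERE (its olean post-dates this append): ★★★ THE F4(c) MILESTONE ✓p718489 `OmegaOneFloorCM.cmCl_stalk_omega1_floor` (res-L1-w45a-stub-3 g14) — every stalk of the Ω₁ floor
`S′ = Bl_{L³ + (g)L²} X_{B9}` satisfies the CM clause (char `p`, `2·3 ≠ 0`); its alias is the first row of the next section. -/

/-- ★ TC-β (Fedder form; `T-cone-transfer.md` regime β): `X·g` passes Fedder at a `k`-point of `{X = 0}` iff `g|_{X=0}` does. [alias of ✓p717528] -/
alias tside_fpure_X_mul_iff := FullXMulRestriction.fpure_X_mul_iff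
/-- ★★ TC-β (stalk form): `CMCl ∧ FCl p` of `k[X,y]_P/(X·g)` at a `k`-point of the divisor ⟺ `(g|_{X=0})^{p−1} ∉ ((yᵢ − βᵢ)^p)`. [alias of ✓p717528] -/
alias tside_clause_X_mul_iff := FullXMulRestriction.clause_X_mul_iff
/-- ★ Regime β is never FULL: `g|_{X=0} = c·Q²`, `Q(β) = 0` ⇒ `(X·g)^{p−1} ∈ (X^p, (yᵢ − βᵢ)^p)`, every prime `p`. [alias of ✓p717528] -/
alias tside_X_mul_pow_mem_of_restrict_eq_mul_sq := FullXMulRestriction.X_mul_pow_mem_of_restrict_eq_mul_sq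
/-- ★★ K6 (ROW #11♯, Lineage Theorem): `ord N ≤ 8` along a lineage (discriminant master formula). [alias of ✓p715854, res-L1-w45a-lead-1] -/
alias tside_lineage_ordN_le_eight := FullLineageDisc.lineage_ordN_le_eight
/-- K6: no wild point along a lineage for `p ≥ 11`. [alias of ✓p715854, res-L1-w45a-lead-1] -/
alias tside_lineage_not_wild := FullLineageDisc.lineage_not_wild
/-- ★★ K7 (ROW #11♯, Point-Chain Cap, provisional-of-record pending the tri-2 break-test): slack domination. [alias of ✓p717266, res-L1-w45a-lead-1] -/
alias tside_slack_domination := FullPointChainCap.slack_domination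
/-- ★★ K7: `ord N ≤ 8` at every rank-one drop point of every chain of point blow-ups. [alias of ✓p717266, res-L1-w45a-lead-1] -/
alias tside_pointChain_ordN_le_eight := FullPointChainCap.pointChain_ordN_le_eight
/-- ★ F5 STRUCTURE: the cure centre `𝓚 = K′·𝒪_{S′}` — every blow-up of the floor along `𝓚` factors through the class model `X̃₂ = Bl_{L·L·K′}X` as a blow-up along `(L+(g))𝒪`.
[alias of ✓p713675, res-L1-w45a-stub-3] -/
alias f5_exists_cure_fac_floor := OmegaCureCentreFactors.exists_cure_fac_floor
/-- F5: FULL of the cured space follows from FULL of that blow-up of `X̃₂`. [alias of ✓p713675, res-L1-w45a-stub-3] -/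
alias f5_fullCl_of_isBlowup_cure := OmegaCureCentreFactors.fullCl_of_isBlowup_cure
/-- ★★ F6 GLUE (affine-open form): FULL stalks of a blow-up along `γ·(u, v)` over a PENCIL chart from FULL of the two pencil rings at every prime. [alias of ✓p713989, res-L1-w45a-stub-3] -/
alias f6_fullCl_stalk_over_pencilChart := PencilBlowupLocalChartsFull.fullCl_stalk_over_pencilChart
/-- ★★ F6 GLUE (stalk form): FULL stalks of `Bl_J Y` over `y` from the pencil rings of `𝒪_{Y,y}`. [alias of ✓p715362/✓p715801, res-L1-w45a-stub-3] -/
alias f6_fullCl_stalk_of_pair_stalk := PencilStalkPackage.fullCl_stalk_of_pair_stalk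
/-- F6 GLUE: the same through germs of global sections. [alias of ✓p715801, res-L1-w45a-stub-3] -/
alias f6_fullCl_stalk_of_pair_germ := PencilStalkPackage.fullCl_stalk_of_pair_germ
/-- F6 ALGEBRA: FULL of the localized pencil rings `(S[X]/(u′X − v′))_𝔔`, `S = M⁻¹A`, from the polynomial model. [alias of ✓p716077, res-L1-w45a-stub-3] -/
alias f6_fullCl_loc_pencilQuot_of_isLocalization := PencilQuotLocalization.fullCl_loc_pencilQuot_of_isLocalization

/-! ## §11 (v8) ★★★ THE F4(c) MILESTONE (res-L1-w45a-stub-3 g14, ✓p718489): every stalk of the Ω₁ floor `S′ = Bl_{L³ + (g)L²} X_{B9}` satisfies the CM clause -/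

/-- ★★★ **F4(c) MILESTONE — THE Ω₁ FLOOR IS COHEN–MACAULAY AT EVERY STALK**: for `f = z² + x⁹ + y⁹ + u⁹ + t⁹` over any field of characteristic `p` with `2·3 ≠ 0`, every stalk of
`S′ = affineBlowup (L³ + (x·u² − y³)·L²)` (`L` the class centre `genSet 5 AL2`) satisfies `CMCl` (25 charts: 12 pencil packages (P) + 13 principal packages (Q), two-engine chart table).
[alias of ✓p718489, res-L1-w45a-stub-3] -/
alias f4c_cmCl_stalk_omega1_floor := OmegaOneFloorCM.cmCl_stalk_omega1_floor

end Summit.ResolutionOfSingularities.ResolutionOfSingularities.Theorems.FInjectiveMacaulayfication.FCensusRegistrar2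

end
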